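import Summits.AtomisticToContinuum.FouriersLaw.Theses.EmbeddedDrudeMourre
import Literature.MathematicalPhysics.KineticTheory.ZeroWavenumberSpace
import Literature.MathematicalPhysics.KineticTheory.InfiniteChainSuperstableDynamics
import Literature.Analysis.UnboundedOperators.HilbertComplexification
import Literature.Analysis.UnboundedOperators.ConjugateOperatorRegularity
import Summits.AtomisticToContinuum.FouriersLaw.Theorems.EmbeddedDrudeMourreMourreDissolutionReflectionOddReduction
import Summits.AtomisticToContinuum.FouriersLaw.Theorems.EmbeddedDrudeMourreMourreDissolutionLAPVirial
import HarnessLib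

/-!
# The odd-sector Mourre estimate kills the current's Drude weight (milestone `NoOddDrudeWeight`)

Crux stmt-AtomisticToContinuum-12594 (`EmbeddedDrudeMourre.MourreDissolution`), line
`separable-vertex-faddeev-pair-sector`, lead file toward the hardest stub `stub_oddSectorMourreEstimate`
(S5). The route's first typed milestone inside the engine is `NoOddDrudeWeight`: `Z.currentDrudeWeight = 0`
(Mazur's loophole closed, not assumed). Here it is DERIVED from the registered statement of S5 by the
virial theorem (`eq_zero_of_hasMourreEstimateOn_of_eigen`, landed with the LAP infrastructure of S6):
the hydrodynamic projection `ℙ[J]` of the current class lies in the reflection-odd sector `𝒦` (because `𝒦`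
reduces the Koopman group) and is `U_t`-invariant, hence its complexification is an eigenvector with
eigenvalue `0 ∈ (−δ, δ)` of the reduced complexified group, hence `0` by the strict Mourre estimate; so
`𝖣_J = ‖ℙ[J]‖² = 0`. The statement is registered as the helper stub `currentDrudeWeight_eq_zero_of_stub5`.
-/

noncomputable section

namespace Summit.AtomisticToContinuum.FouriersLaw.Theorems.MourreDissolution

open Filter Topology MeasureTheory Set
open scoped InnerProductSpace ComplexConjugate
open Literature.MathematicalPhysics.KineticTheory
open Literature.MathematicalPhysics.KineticTheory.HeatConduction
open Literature.Analysis.UnboundedOperators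

/-- A bounded operator on the fluctuation space commuting with every `U_t`, together with its adjoint,
commutes with the hydrodynamic projection `ℙ` (both preserve the conserved space `𝒬₀`, and `B` preserves
`𝒬₀ᗮ`). Used with the orthogonal projection onto a reducing subspace. [folklore] -/
theorem hydroProjection_comm_of_comm : ∀ (Dy : Literature.MathematicalPhysics.KineticTheory.FluctuationDynamics (MeasureTheory.Measure.count : MeasureTheory.Measure ℤ) Literature.MathematicalPhysics.KineticTheory.HeatConduction.chainShift) (B : Dy.FluctuationSpace →L[ℝ] Dy.FluctuationSpace), (∀ (t : ℝ) (ψ : Dy.FluctuationSpace), B (Dy.koopman t ψ) = Dy.koopman t (B ψ)) → (∀ (t : ℝ) (ψ : Dy.FluctuationSpace), (ContinuousLinearMap.adjoint B) (Dy.koopman t ψ) = Dy.koopman t ((ContinuousLinearMap.adjoint B) ψ)) → ∀ (ψ : Dy.FluctuationSpace), Dy.hydroProjection (B ψ) = B (Dy.hydroProjection ψ) := by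
  intro Dy B hB hBa ψ
  -- `B` and `B†` map `𝒬₀` into itself
  have hmapB : ∀ φ ∈ Dy.conservedSpace, B φ ∈ Dy.conservedSpace := fun φ hφ t => by
    show Dy.koopman t (B φ) = B φ
    rw [← hB t φ]
    exact congrArg B (hφ t)
  have hmapBa : ∀ φ ∈ Dy.conservedSpace, (ContinuousLinearMap.adjoint B) φ ∈ Dy.conservedSpace :=
    fun φ hφ t => by
      show Dy.koopman t ((ContinuousLinearMap.adjoint B) φ) = (ContinuousLinearMap.adjoint B) φ
      rw [← hBa t φ]
      exact congrArg (ContinuousLinearMap.adjoint B) (hφ t)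
  -- decompose `ψ = ℙψ + (ψ - ℙψ)` with `ψ - ℙψ ⊥ 𝒬₀`
  have hperp : ψ - Dy.hydroProjection ψ ∈ Dy.conservedSpaceᗮ :=
    Dy.conservedSpace.sub_starProjection_mem_orthogonal ψ
  have hBperp : B (ψ - Dy.hydroProjection ψ) ∈ Dy.conservedSpaceᗮ := by
    rw [Submodule.mem_orthogonal'] at hperp ⊢
    intro u hu
    rw [← ContinuousLinearMap.adjoint_inner_right]
    exact hperp _ (hmapBa u hu)
  have hsplit : B ψ = B (Dy.hydroProjection ψ) + B (ψ - Dy.hydroProjection ψ) := by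
    rw [← map_add, add_sub_cancel]
  rw [hsplit, map_add, Dy.hydroProjection_eq_self (hmapB _ (Dy.hydroProjection_mem ψ)),
    (Dy.hydroProjection_eq_zero_iff _).2 hBperp, add_zero]


/-- **No ι-odd conserved class** (registered helper stub `oddInvariant_eq_zero_of_stub5`): IF the
registered statement of `stub_oddSectorMourreEstimate` holds, then for `T < T₀` and every regular
symmetric framework, the reflection-odd sector `𝒦 = ℋ₀^{ι−}` contains NO non-zero `U_t`-invariant vector
— the precise anti-Mazur content of the engine (virial theorem `eq_zero_of_hasMourreEstimateOn_of_eigen`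
at the eigenvalue `0 ∈ (−δ, δ)` of the complexified reduced group).
[cite: Mourre1981] [cite: AmreinBoutetdeMonvelGeorgescu1996, Prop. 7.2.10] -/
theorem oddInvariant_eq_zero_of_stub5 : (∀ ω₂ lam β γ : ℝ, 0 < ω₂ → 0 < lam → 0 < β → 0 < γ → Literature.MathematicalPhysics.KineticTheory.PhononBoltzmann.HasOddSectorGap ω₂ lam β → ∃ T₀ : ℝ, 0 < T₀ ∧ ∀ T : ℝ, 0 < T → T < T₀ → ∀ (D : Literature.MathematicalPhysics.KineticTheory.HeatConduction.InfiniteChainDynamics (Literature.MathematicalPhysics.KineticTheory.HeatConduction.pinnedChain ω₂ lam β γ)) (Z : Literature.MathematicalPhysics.KineticTheory.HeatConduction.ZeroWavenumberData (Literature.MathematicalPhysics.KineticTheory.HeatConduction.pinnedChain ω₂ lam β γ) D), D.carrier = (Literature.MathematicalPhysics.KineticTheory.HeatConduction.pinnedChain ω₂ lam β γ).bmGood → (Literature.MathematicalPhysics.KineticTheory.HeatConduction.pinnedChain ω₂ lam β γ).IsChainGibbsMeasure T Z.μ → (Literature.MathematicalPhysics.KineticTheory.HeatConduction.pinnedChain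 ω₂ lam β γ).HasSuperstabilityEstimate Z.μ → Z.HasMomentumReversal → MeasureTheory.MeasurePreserving (fun (σ : ℤ → ℝ × ℝ) (x : ℤ) => σ (-x)) Z.μ Z.μ → (∀ a : (ℤ → ℝ × ℝ) → ℝ, a ∈ Z.localObs → (a ∘ fun (σ : ℤ → ℝ × ℝ) (x : ℤ) => σ (-x)) ∈ Z.localObs) → (∀ t : ℝ, (fun (σ : ℤ → ℝ × ℝ) (x : ℤ) => σ (-x)) ∘ D.flow t =ᵐ[Z.μ] D.flow t ∘ fun (σ : ℤ → ℝ × ℝ) (x : ℤ) => σ (-x)) → (∀ ψ : Literature.MathematicalPhysics.KineticTheory.HeatConduction.ZeroWavenumberSpace Z, Continuous fun t : ℝ => Z.koopman t ψ) → ∀ (𝒦 : Submodule ℝ (Literature.MathematicalPhysics.KineticTheory.HeatConduction.ZeroWavenumberSpace Z)) [CompleteSpace ↥𝒦], 𝒦 = (Submodule.span ℝ {ψ : Literature.MathematicalPhysics.KineticTheory.HeatConduction.ZeroWavenumberSpace Z | ∃ a : (ℤ → ℝ × ℝ) → ℝ, a ∈ Z.localObs ∧ ψ = Z.fluct a - Z.fluct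 (a ∘ fun (σ : ℤ → ℝ × ℝ) (x : ℤ) => σ (-x))}).topologicalClosure → ∀ (hJ : Z.currentClass ∈ 𝒦) (V : ℝ → ↥𝒦 →L[ℝ] ↥𝒦) (h0 : V 0 = ContinuousLinearMap.id ℝ ↥𝒦) (hadd : ∀ s t : ℝ, V (s + t) = (V s).comp (V t)) (hnorm : ∀ (t : ℝ) (ψ : ↥𝒦), ‖V t ψ‖ = ‖ψ‖) (hcont : ∀ ψ : ↥𝒦, Continuous fun t : ℝ => V t ψ), (∀ (t : ℝ) (ψ : ↥𝒦), ((V t ψ : ↥𝒦) : Literature.MathematicalPhysics.KineticTheory.HeatConduction.ZeroWavenumberSpace Z) = Z.koopman t (ψ : Literature.MathematicalPhysics.KineticTheory.HeatConduction.ZeroWavenumberSpace Z)) → ∃ (A : Literature.Analysis.UnboundedOperators.OneParameterUnitaryGroup (Literature.Analysis.UnboundedOperators.Complexification ↥𝒦)) (δ a : ℝ), 0 < δ ∧ 0 < a ∧ (Literature.Analysis.UnboundedOperators.Complexification.unitaryGroupOfReal V h0 hadd hnorm hcont).HamiltonianOfClassC1 A ∧ (Literature.Analysis.UnboundedOperators.Complexification.unitaryGroupOfReal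 V h0 hadd hnorm hcont).HamiltonianOfClassC11 A ∧ (Literature.Analysis.UnboundedOperators.Complexification.unitaryGroupOfReal V h0 hadd hnorm hcont).HasMourreEstimateOn A (Set.Ioo (-δ) δ) a ∧ Literature.Analysis.UnboundedOperators.Complexification.ofReal (⟨Z.currentClass, hJ⟩ : ↥𝒦) ∈ A.hamiltonian.domain) → ∀ ω₂ lam β γ : ℝ, 0 < ω₂ → 0 < lam → 0 < β → 0 < γ → Literature.MathematicalPhysics.KineticTheory.PhononBoltzmann.HasOddSectorGap ω₂ lam β → ∃ T₀ : ℝ, 0 < T₀ ∧ ∀ T : ℝ, 0 < T → T < T₀ → ∀ (D : Literature.MathematicalPhysics.KineticTheory.HeatConduction.InfiniteChainDynamics (Literature.MathematicalPhysics.KineticTheory.HeatConduction.pinnedChain ω₂ lam β γ)) (Z : Literature.MathematicalPhysics.KineticTheory.HeatConduction.ZeroWavenumberData (Literature.MathematicalPhysics.KineticTheory.HeatConduction.pinnedChain ω₂ lam β γ) D), D.carrier = (Literature.MathematicalPhysics.KineticTheory.HeatConduction.pinnedChain ω₂ lam β γ).bmGood → (Literature.MathematicalPhysics.KineticTheory.HeatConduction.pinnedChain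 ω₂ lam β γ).IsChainGibbsMeasure T Z.μ → (Literature.MathematicalPhysics.KineticTheory.HeatConduction.pinnedChain ω₂ lam β γ).HasSuperstabilityEstimate Z.μ → Z.HasMomentumReversal → MeasureTheory.MeasurePreserving (fun (σ : ℤ → ℝ × ℝ) (x : ℤ) => σ (-x)) Z.μ Z.μ → (∀ a : (ℤ → ℝ × ℝ) → ℝ, a ∈ Z.localObs → (a ∘ fun (σ : ℤ → ℝ × ℝ) (x : ℤ) => σ (-x)) ∈ Z.localObs) → (∀ t : ℝ, (fun (σ : ℤ → ℝ × ℝ) (x : ℤ) => σ (-x)) ∘ D.flow t =ᵐ[Z.μ] D.flow t ∘ fun (σ : ℤ → ℝ × ℝ) (x : ℤ) => σ (-x)) → (∀ ψ : Literature.MathematicalPhysics.KineticTheory.HeatConduction.ZeroWavenumberSpace Z, Continuous fun t : ℝ => Z.koopman t ψ) → ∀ ψ : Literature.MathematicalPhysics.KineticTheory.HeatConduction.ZeroWavenumberSpace Z, ψ ∈ (Submodule.span ℝ {ψ : Literature.MathematicalPhysics.KineticTheory.HeatConduction.ZeroWavenumberSpace Z | ∃ a : (ℤ → ℝ × ℝ)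 → ℝ, a ∈ Z.localObs ∧ ψ = Z.fluct a - Z.fluct (a ∘ fun (σ : ℤ → ℝ × ℝ) (x : ℤ) => σ (-x))}).topologicalClosure → (∀ t : ℝ, Z.koopman t ψ = ψ) → ψ = 0 := by
  intro hS5 ω₂ lam β γ hω hl hβ hγ hGap
  obtain ⟨T₀, hT₀, hM⟩ := hS5 ω₂ lam β γ hω hl hβ hγ hGap
  refine ⟨T₀, hT₀, fun T hT hTlt D Z hDcar hGibbs hSS hRev hιμ hιobs hιflow hsc ψ hψ hinv => ?_⟩
  -- the reflection-odd sector and the restricted Koopman group (landed Stub 4)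
  obtain ⟨𝒦, h𝒦⟩ : ∃ 𝒦 : Submodule ℝ (ZeroWavenumberSpace Z), 𝒦 = (Submodule.span ℝ
      {ψ : ZeroWavenumberSpace Z | ∃ a : (ℤ → ℝ × ℝ) → ℝ, a ∈ Z.localObs ∧
        ψ = Z.fluct a - Z.fluct (a ∘ fun (σ : ℤ → ℝ × ℝ) (x : ℤ) => σ (-x))}).topologicalClosure :=
    ⟨_, rfl⟩
  rw [← h𝒦] at hψ
  haveI h𝒦c : CompleteSpace ↥𝒦 := by rw [h𝒦]; infer_instance
  obtain ⟨hJ, V, h0, hadd, hnorm, hcont, hagree⟩ :=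
    stub_reflectionOddReduction ω₂ lam β γ D Z hιobs hιflow hsc 𝒦 h𝒦
  obtain ⟨A, δ, a, hδ, ha, -, -, hMourre, -⟩ :=
    hM T hT hTlt D Z hDcar hGibbs hSS hRev hιμ hιobs hιflow hsc 𝒦 h𝒦 hJ V h0 hadd hnorm hcont hagree
  -- in `𝒦`, then complexified: an eigenvector with eigenvalue `0`
  set k₀ : ↥𝒦 := ⟨ψ, hψ⟩ with hk₀
  have hVk : ∀ t, V t k₀ = k₀ := fun t => Subtype.ext (by rw [hagree t k₀]; exact hinv t)
  set U := Complexification.unitaryGroupOfReal V h0 hadd hnorm hcont with hU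
  have heig : ∀ t, U.appReal t (Complexification.ofReal k₀) =
      Complex.exp ((((0 : ℝ) * t : ℝ) : ℂ) * Complex.I) • Complexification.ofReal k₀ := fun t => by
    rw [hU, Complexification.unitaryGroupOfReal_appReal_ofReal, hVk t]
    simp
  have hzero : Complexification.ofReal k₀ = 0 :=
    eq_zero_of_hasMourreEstimateOn_of_eigen hMourre ha isOpen_Ioo (E := 0) ⟨by linarith, by linarith⟩
      heig
  have hk₀0 : k₀ = 0 := by
    have : ‖Complexification.ofReal k₀‖ = ‖k₀‖ := Complexification.ofReal.norm_map k₀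
    rw [hzero, norm_zero] at this
    exact norm_eq_zero.1 this.symm
  have := congrArg Subtype.val hk₀0
  simpa [hk₀] using this

/-- **`NoOddDrudeWeight` from the odd-sector Mourre estimate** (registered helper stub
`currentDrudeWeight_eq_zero_of_stub5`): IF the registered statement of `stub_oddSectorMourreEstimate`
holds, then for `T < T₀` every regular symmetric framework has `Z.currentDrudeWeight = 0` — the energy
current overlaps no conserved class of `ℋ₀` (Mazur's ballistic loophole is closed by the engine, not
assumed; this is the route's milestone `NoOddDrudeWeight` and the necessary condition of Disproof v2).
Proof: `𝒦 = ℋ₀^{ι−}` REDUCES `U_t` (landed Stub 4 gives `U_t𝒦 ⊆ 𝒦`, unitarity gives `U_t𝒦ᗮ ⊆ 𝒦ᗮ`), so the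
orthogonal projection onto `𝒦` commutes with `U_t` and with `ℙ` (`hydroProjection_comm_of_comm`); hence
`ℙ[J] ∈ 𝒦` is a `U_t`-invariant odd vector, zero by `oddInvariant_eq_zero_of_stub5`, and `𝖣_J = ‖ℙ[J]‖² = 0`.
[cite: Mourre1981] [cite: Doyon2022, §5.1 Thm 5.1] -/
theorem currentDrudeWeight_eq_zero_of_stub5 : (∀ ω₂ lam β γ : ℝ, 0 < ω₂ → 0 < lam → 0 < β → 0 < γ → Literature.MathematicalPhysics.KineticTheory.PhononBoltzmann.HasOddSectorGap ω₂ lam β → ∃ T₀ : ℝ, 0 < T₀ ∧ ∀ T : ℝ, 0 < T → T < T₀ → ∀ (D : Literature.MathematicalPhysics.KineticTheory.HeatConduction.InfiniteChainDynamics (Literature.MathematicalPhysics.KineticTheory.HeatConduction.pinnedChain ω₂ lam β γ)) (Z : Literature.MathematicalPhysics.KineticTheory.HeatConduction.ZeroWavenumberData (Literature.MathematicalPhysics.KineticTheory.HeatConduction.pinnedChain ω₂ lam β γ) D), D.carrier = (Literature.MathematicalPhysics.KineticTheory.HeatConduction.pinnedChain ω₂ lam β γ).bmGood → (Literature.MathematicalPhysics.KineticTheory.HeatConduction.pinnedChain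 ω₂ lam β γ).IsChainGibbsMeasure T Z.μ → (Literature.MathematicalPhysics.KineticTheory.HeatConduction.pinnedChain ω₂ lam β γ).HasSuperstabilityEstimate Z.μ → Z.HasMomentumReversal → MeasureTheory.MeasurePreserving (fun (σ : ℤ → ℝ × ℝ) (x : ℤ) => σ (-x)) Z.μ Z.μ → (∀ a : (ℤ → ℝ × ℝ) → ℝ, a ∈ Z.localObs → (a ∘ fun (σ : ℤ → ℝ × ℝ) (x : ℤ) => σ (-x)) ∈ Z.localObs) → (∀ t : ℝ, (fun (σ : ℤ → ℝ × ℝ) (x : ℤ) => σ (-x)) ∘ D.flow t =ᵐ[Z.μ] D.flow t ∘ fun (σ : ℤ → ℝ × ℝ) (x : ℤ) => σ (-x)) → (∀ ψ : Literature.MathematicalPhysics.KineticTheory.HeatConduction.ZeroWavenumberSpace Z, Continuous fun t : ℝ => Z.koopman t ψ) → ∀ (𝒦 : Submodule ℝ (Literature.MathematicalPhysics.KineticTheory.HeatConduction.ZeroWavenumberSpace Z)) [CompleteSpace ↥𝒦], 𝒦 = (Submodule.span ℝ {ψ : Literature.MathematicalPhysics.KineticTheory.HeatConduction.ZeroWavenumberSpace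 Z | ∃ a : (ℤ → ℝ × ℝ) → ℝ, a ∈ Z.localObs ∧ ψ = Z.fluct a - Z.fluct (a ∘ fun (σ : ℤ → ℝ × ℝ) (x : ℤ) => σ (-x))}).topologicalClosure → ∀ (hJ : Z.currentClass ∈ 𝒦) (V : ℝ → ↥𝒦 →L[ℝ] ↥𝒦) (h0 : V 0 = ContinuousLinearMap.id ℝ ↥𝒦) (hadd : ∀ s t : ℝ, V (s + t) = (V s).comp (V t)) (hnorm : ∀ (t : ℝ) (ψ : ↥𝒦), ‖V t ψ‖ = ‖ψ‖) (hcont : ∀ ψ : ↥𝒦, Continuous fun t : ℝ => V t ψ), (∀ (t : ℝ) (ψ : ↥𝒦), ((V t ψ : ↥𝒦) : Literature.MathematicalPhysics.KineticTheory.HeatConduction.ZeroWavenumberSpace Z) = Z.koopman t (ψ : Literature.MathematicalPhysics.KineticTheory.HeatConduction.ZeroWavenumberSpace Z)) → ∃ (A : Literature.Analysis.UnboundedOperators.OneParameterUnitaryGroup (Literature.Analysis.UnboundedOperators.Complexification ↥𝒦)) (δ a : ℝ), 0 < δ ∧ 0 < a ∧ (Literature.Analysis.UnboundedOperators.Complexification.unitaryGroupOfReal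 V h0 hadd hnorm hcont).HamiltonianOfClassC1 A ∧ (Literature.Analysis.UnboundedOperators.Complexification.unitaryGroupOfReal V h0 hadd hnorm hcont).HamiltonianOfClassC11 A ∧ (Literature.Analysis.UnboundedOperators.Complexification.unitaryGroupOfReal V h0 hadd hnorm hcont).HasMourreEstimateOn A (Set.Ioo (-δ) δ) a ∧ Literature.Analysis.UnboundedOperators.Complexification.ofReal (⟨Z.currentClass, hJ⟩ : ↥𝒦) ∈ A.hamiltonian.domain) → ∀ ω₂ lam β γ : ℝ, 0 < ω₂ → 0 < lam → 0 < β → 0 < γ → Literature.MathematicalPhysics.KineticTheory.PhononBoltzmann.HasOddSectorGap ω₂ lam β → ∃ T₀ : ℝ, 0 < T₀ ∧ ∀ T : ℝ, 0 < T → T < T₀ → ∀ (D : Literature.MathematicalPhysics.KineticTheory.HeatConduction.InfiniteChainDynamics (Literature.MathematicalPhysics.KineticTheory.HeatConduction.pinnedChain ω₂ lam β γ)) (Z : Literature.MathematicalPhysics.KineticTheory.HeatConduction.ZeroWavenumberData (Literature.MathematicalPhysics.KineticTheory.HeatConduction.pinnedChain ω₂ lam β γ) D), D.carrier = (Literature.MathematicalPhysics.KineticTheory.HeatConduction.pinnedChain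 ω₂ lam β γ).bmGood → (Literature.MathematicalPhysics.KineticTheory.HeatConduction.pinnedChain ω₂ lam β γ).IsChainGibbsMeasure T Z.μ → (Literature.MathematicalPhysics.KineticTheory.HeatConduction.pinnedChain ω₂ lam β γ).HasSuperstabilityEstimate Z.μ → Z.HasMomentumReversal → MeasureTheory.MeasurePreserving (fun (σ : ℤ → ℝ × ℝ) (x : ℤ) => σ (-x)) Z.μ Z.μ → (∀ a : (ℤ → ℝ × ℝ) → ℝ, a ∈ Z.localObs → (a ∘ fun (σ : ℤ → ℝ × ℝ) (x : ℤ) => σ (-x)) ∈ Z.localObs) → (∀ t : ℝ, (fun (σ : ℤ → ℝ × ℝ) (x : ℤ) => σ (-x)) ∘ D.flow t =ᵐ[Z.μ] D.flow t ∘ fun (σ : ℤ → ℝ × ℝ) (x : ℤ) => σ (-x)) → (∀ ψ : Literature.MathematicalPhysics.KineticTheory.HeatConduction.ZeroWavenumberSpace Z, Continuous fun t : ℝ => Z.koopman t ψ) → Z.currentDrudeWeight = 0 := by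
  intro hS5 ω₂ lam β γ hω hl hβ hγ hGap
  obtain ⟨T₀, hT₀, hM⟩ := oddInvariant_eq_zero_of_stub5 hS5 ω₂ lam β γ hω hl hβ hγ hGap
  refine ⟨T₀, hT₀, fun T hT hTlt D Z hDcar hGibbs hSS hRev hιμ hιobs hιflow hsc => ?_⟩
  -- the reflection-odd sector and the restricted Koopman group (landed Stub 4)
  obtain ⟨𝒦, h𝒦⟩ : ∃ 𝒦 : Submodule ℝ (ZeroWavenumberSpace Z), 𝒦 = (Submodule.span ℝ
      {ψ : ZeroWavenumberSpace Z | ∃ a : (ℤ → ℝ × ℝ) → ℝ, a ∈ Z.localObs ∧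
        ψ = Z.fluct a - Z.fluct (a ∘ fun (σ : ℤ → ℝ × ℝ) (x : ℤ) => σ (-x))}).topologicalClosure :=
    ⟨_, rfl⟩
  haveI h𝒦c : CompleteSpace ↥𝒦 := by rw [h𝒦]; infer_instance
  obtain ⟨hJ, V, h0, hadd, hnorm, hcont, hagree⟩ :=
    stub_reflectionOddReduction ω₂ lam β γ D Z hιobs hιflow hsc 𝒦 h𝒦
  -- `𝒦` reduces the Koopman group: `U_t 𝒦 ⊆ 𝒦` and `U_t 𝒦ᗮ ⊆ 𝒦ᗮ`
  have hK : ∀ (t : ℝ), ∀ ψ ∈ 𝒦, Z.koopman t ψ ∈ 𝒦 := fun t ψ hψ => by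
    rw [← hagree t ⟨ψ, hψ⟩]; exact (V t ⟨ψ, hψ⟩).2
  have hKperp : ∀ (t : ℝ), ∀ u ∈ 𝒦ᗮ, Z.koopman t u ∈ 𝒦ᗮ := fun t u hu => by
    rw [Submodule.mem_orthogonal] at hu ⊢
    intro k hk
    have hk' := hK (-t) k hk
    have h1 := hu _ hk'
    have e : Z.koopman t (Z.koopman (-t) k) = k := by
      show Z.toFluctuationDynamics.koopman t (Z.toFluctuationDynamics.koopman (-t) k) = k
      rw [← FluctuationDynamics.koopman_add_apply, add_neg_cancel, FluctuationDynamics.koopman_zero_apply]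
    rw [← e, (Z.koopman t).inner_map_map]
    exact h1
  -- hence the orthogonal projection `B` onto `𝒦` commutes with every `U_t`
  set B : ZeroWavenumberSpace Z →L[ℝ] ZeroWavenumberSpace Z := 𝒦.starProjection with hBdef
  have hB : ∀ t ψ, B (Z.koopman t ψ) = Z.koopman t (B ψ) := fun t ψ => by
    have h1 : Z.koopman t (B ψ) ∈ 𝒦 := hK t _ (𝒦.starProjection_apply_mem ψ)
    have h2 : Z.koopman t (ψ - B ψ) ∈ 𝒦ᗮ := hKperp t _ (𝒦.sub_starProjection_mem_orthogonal ψ)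
    have hsplit : Z.koopman t ψ = Z.koopman t (B ψ) + Z.koopman t (ψ - B ψ) := by
      rw [← map_add, add_sub_cancel]
    rw [hsplit, map_add, (Submodule.starProjection_eq_self_iff).2 h1,
      (Submodule.starProjection_apply_eq_zero_iff 𝒦).2 h2, add_zero]
  have hBadj : ContinuousLinearMap.adjoint B = B :=
    (ContinuousLinearMap.isSelfAdjoint_iff'.1 (isSelfAdjoint_starProjection 𝒦))
  have hBa : ∀ t ψ, (ContinuousLinearMap.adjoint B) (Z.koopman t ψ) =
      Z.koopman t ((ContinuousLinearMap.adjoint B) ψ) := by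
    rw [hBadj]; exact hB
  -- `ψ₀ := ℙ[J]` lies in `𝒦` and is `U_t`-invariant, hence zero
  set ψ₀ : ZeroWavenumberSpace Z := Z.toFluctuationDynamics.hydroProjection Z.currentClass with hψ₀
  have hBJ : B Z.currentClass = Z.currentClass := (Submodule.starProjection_eq_self_iff).2 hJ
  have hψ₀K : ψ₀ ∈ 𝒦 := by
    have h := hydroProjection_comm_of_comm Z.toFluctuationDynamics B hB hBa Z.currentClass
    have h1 : ψ₀ = B ψ₀ := (congrArg Z.toFluctuationDynamics.hydroProjection hBJ.symm).trans h
    rw [h1]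
    exact 𝒦.starProjection_apply_mem _
  have hinv : ∀ t, Z.koopman t ψ₀ = ψ₀ := fun t =>
    Z.toFluctuationDynamics.koopman_hydroProjection t Z.currentClass
  have hψ₀0 : ψ₀ = 0 :=
    hM T hT hTlt D Z hDcar hGibbs hSS hRev hιμ hιobs hιflow hsc ψ₀ (h𝒦 ▸ hψ₀K) hinv
  have hP0 : Z.toFluctuationDynamics.hydroProjection Z.currentClass = 0 := by
    rw [← hψ₀]; exact hψ₀0
  show Z.toFluctuationDynamics.drudeWeight Z.currentClass = 0
  rw [FluctuationDynamics.drudeWeight_def, hP0, norm_zero]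
  norm_num

end Summit.AtomisticToContinuum.FouriersLaw.Theorems.MourreDissolution

end
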